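import Summits.NavierStokesRegularity.NavierStokesRegularity.Theorems.RellichScarScarRigidityApexRegularityExchange
import Literature.Analysis.FluidPDE.PressurePoisson
import Literature.Analysis.FluidPDE.LerayProfileCalculus
import HarnessLib

/-!
# `ScarRigidity` — line `SketchIdeator6` (skeleton v2), stub `stub_scalingGeneratorSolvesLinearised` (P2)
# (crux stmt-NavierStokesRegularity-11717, route RellichScar)

**P2 — the scaling generator solves the linearised Navier–Stokes system.**
Let `(V, Q)` be a classical solution of Navier–Stokes (`ν = 1`, no force) on the open backward slab
`(−∞,0) × ℝ³`.  The scaling generator `z = V + (x·∇)V + 2t ∂ₜV = (d/dλ)|₁ λV(λ²t, λx)` with the pressure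
`q_z = 2Q + (x·∇)Q + 2t ∂ₜQ = (d/dλ)|₁ λ²Q(λ²t, λx)` is jointly smooth, divergence free, and solves
`∂ₜz + (V·∇)z + (z·∇)V = Δz − ∇q_z`.

Proof (pure calculus).  Write `𝒮 = 1 + x·∇ + 2t∂ₜ`.  The commutators of the radial derivative `x·∇` with the
operators of the equation are
* `Δ((x·∇)f) = (x·∇)Δf + 2Δf` (`laplacian_fderiv_apply_self`),
* `∇((x·∇)q) = (x·∇)∇q + ∇q` (`gradient_fderiv_apply_self`),
* `(V·∇)((x·∇)V) + (((x·∇)V)·∇)V = (x·∇)((V·∇)V) + (V·∇)V` (`convect_fderiv_apply_self_add`),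
* `div((x·∇)V) = (x·∇)div V + div V = 0` (the tree's `divergence_fderiv_apply_self_eq_zero`),
all instances of `∂ᵢ((x·∇)f) = (x·∇)∂ᵢf + ∂ᵢf` (`fderiv_fderiv_apply_self_apply`, product rule + Schwarz);
`∂ₜ` commutes with `Δ`, `∇`, `D` on the open slab (the tree's exchange lemmas `hasDerivAt_iteratedFDeriv_slice`,
`hasDerivAt_fderiv_slice_clm`), and `∂ₜ(2t∂ₜf) = 2∂ₜf + 2t∂ₜ²f`.  Applying `x·∇` and `∂ₜ` to the momentum
equation `∂ₜV = ΔV − ∇Q − (V·∇)V` and adding up gives the linearised equation for `(z, q_z)`; `div z = 0`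
likewise.  Mathlib + the tree's space–time calculus only.
-/

noncomputable section

open Set Filter Function MeasureTheory Metric TopologicalSpace
open scoped Topology ENNReal NNReal InnerProductSpace RealInnerProductSpace ContDiff Laplacian

set_option linter.dupNamespace false

-- nested operator types (`ℝ³ →L[ℝ] ℝ³ →L[ℝ] ℝ³`)
set_option maxSynthPendingDepth 4

namespace Summit.NavierStokesRegularity.NavierStokesRegularity.Theorems.RellichScarScarRigidity

open Literature.Analysis.FluidPDE

/-- Physical space. -/
local notation "ℝ³" => EuclideanSpace ℝ (Fin 3)

/-! ## The radial derivative `(x·∇)f = Df(x)x` and its commutators -/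

section Radial

variable {F : Type*} [NormedAddCommGroup F] [NormedSpace ℝ F]

/-- **`∂ₐ((x·∇)f) = (x·∇)(∂ₐf) + ∂ₐf`** for `f ∈ C²`: the derivative of the radial derivative
`y ↦ Df(y)y` (product rule, then Schwarz to move `a` inside). [folklore] -/
private theorem fderiv_fderiv_apply_self_apply {f : ℝ³ → F} (hf : ContDiff ℝ 2 f) (y a : ℝ³) :
    fderiv ℝ (fun z => fderiv ℝ f z z) y a = fderiv ℝ (fun z => fderiv ℝ f z a) y y + fderiv ℝ f y a := by
  have hD : HasFDerivAt (fderiv ℝ f) (fderiv ℝ (fderiv ℝ f) y) y :=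
    (((hf.fderiv_right (m := 1) le_rfl).differentiable one_ne_zero) y).hasFDerivAt
  have hg : HasFDerivAt (fun z => fderiv ℝ f z z)
      ((fderiv ℝ f y).comp (ContinuousLinearMap.id ℝ ℝ³) + (fderiv ℝ (fderiv ℝ f) y).flip y) y :=
    hD.clm_apply (hasFDerivAt_id y)
  rw [hg.fderiv, add_apply, ContinuousLinearMap.comp_apply,
    ContinuousLinearMap.id_apply, ContinuousLinearMap.flip_apply, fderiv_fderiv_apply_eq hf y a, add_comm]

/-- **`Δ((x·∇)f) = (x·∇)(Δf) + 2Δf`** for `f ∈ C³` (apply `∂ᵢ((x·∇)f) = (x·∇)∂ᵢf + ∂ᵢf` twice and sum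
over an orthonormal basis). [folklore] -/
private theorem laplacian_fderiv_apply_self {f : ℝ³ → ℝ³} (hf : ContDiff ℝ 3 f) (x : ℝ³) :
    (Δ (fun y => fderiv ℝ f y y)) x = fderiv ℝ (Δ f) x x + (2 : ℝ) • (Δ f) x := by
  set b := stdOrthonormalBasis ℝ ℝ³
  have hf2 : ContDiff ℝ 2 f := hf.of_le (by norm_num)
  have hφ : ∀ a : ℝ³, ContDiff ℝ 2 (fun z => fderiv ℝ f z a) := fun a =>
    (hf.fderiv_right (m := 2) le_rfl).clm_apply contDiff_const
  have hψ : ∀ a c : ℝ³, ContDiff ℝ 1 (fun y => fderiv ℝ (fun z => fderiv ℝ f z a) y c) := fun a c =>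
    ((hφ a).fderiv_right (m := 1) le_rfl).clm_apply contDiff_const
  have hg : ContDiff ℝ 2 (fun y => fderiv ℝ f y y) :=
    (hf.fderiv_right (m := 2) le_rfl).clm_apply contDiff_id
  -- `∂ₐ((x·∇)f) = (x·∇)(∂ₐf) + ∂ₐf` as functions
  have h1 : ∀ a : ℝ³, (fun y => fderiv ℝ (fun z => fderiv ℝ f z z) y a) =
      fun y => fderiv ℝ (fun z => fderiv ℝ f z a) y y + fderiv ℝ f y a := fun a =>
    funext fun y => fderiv_fderiv_apply_self_apply hf2 y a
  -- `∂ₐ∂ₐ((x·∇)f) = (x·∇)(∂ₐ∂ₐf) + 2∂ₐ∂ₐf`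
  have h2 : ∀ a : ℝ³, fderiv ℝ (fun y => fderiv ℝ (fun z => fderiv ℝ f z z) y a) x a =
      fderiv ℝ (fun y => fderiv ℝ (fun z => fderiv ℝ f z a) y a) x x
        + (2 : ℝ) • fderiv ℝ (fun z => fderiv ℝ f z a) x a := by
    intro a
    have hd1 : DifferentiableAt ℝ (fun y => fderiv ℝ (fun z => fderiv ℝ f z a) y y) x :=
      ((((hφ a).fderiv_right (m := 1) le_rfl).differentiable one_ne_zero) x).clm_apply
        differentiableAt_id
    have hd2 : DifferentiableAt ℝ (fun z => fderiv ℝ f z a) x := ((hφ a).differentiable two_ne_zero) x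
    rw [h1 a, fderiv_fun_add hd1 hd2, add_apply,
      fderiv_fderiv_apply_self_apply (hφ a) x a, two_smul]
    abel
  rw [laplacian_eq_sum_fderiv_fderiv b hg x]
  simp_rw [h2]
  rw [Finset.sum_add_distrib, ← Finset.smul_sum]
  have hΔ : Δ f = fun y => ∑ i, fderiv ℝ (fun z => fderiv ℝ f z (b i)) y (b i) :=
    funext fun y => laplacian_eq_sum_fderiv_fderiv b hf2 y
  rw [hΔ, fderiv_fun_sum fun i _ => ((hψ (b i) (b i)).differentiable one_ne_zero) x,
    sum_apply]

/-- **`∇((x·∇)q) = (x·∇)(∇q) + ∇q`** for a scalar `q ∈ C²`. [folklore] -/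
private theorem gradient_fderiv_apply_self {q : ℝ³ → ℝ} (hq : ContDiff ℝ 2 q) (x : ℝ³) :
    gradient (fun y => fderiv ℝ q y y) x = fderiv ℝ (gradient q) x x + gradient q x := by
  have hD : DifferentiableAt ℝ (fderiv ℝ q) x :=
    ((hq.fderiv_right (m := 1) le_rfl).differentiable one_ne_zero) x
  have e : gradient q = (InnerProductSpace.toDual ℝ ℝ³).symm ∘ fderiv ℝ q := rfl
  have hDg : fderiv ℝ (gradient q) x x = (InnerProductSpace.toDual ℝ ℝ³).symm (fderiv ℝ (fderiv ℝ q) x x) := by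
    rw [e, LinearIsometryEquiv.comp_fderiv]
    rfl
  refine ext_inner_right ℝ fun a => ?_
  rw [inner_gradient_left, inner_add_left, inner_gradient_left, hDg, InnerProductSpace.toDual_symm_apply,
    fderiv_fderiv_apply_self_apply hq x a, fderiv_fderiv_apply_eq hq x a]
  congr 1
  exact (hq.contDiffAt.isSymmSndFDerivAt (n := 2) (by simp)) a x

/-- **`(v·∇)((x·∇)v) + (((x·∇)v)·∇)v = (x·∇)((v·∇)v) + (v·∇)v`** for `v ∈ C²`: the radial derivative is a
derivation up to the commutator `[∂, x·∇] = ∂`. [folklore] -/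
private theorem convect_fderiv_apply_self_add {v : ℝ³ → ℝ³} (hv : ContDiff ℝ 2 v) (x : ℝ³) :
    fderiv ℝ (fun y => fderiv ℝ v y y) x (v x) + fderiv ℝ v x (fderiv ℝ v x x) =
      fderiv ℝ (fun y => fderiv ℝ v y (v y)) x x + fderiv ℝ v x (v x) := by
  have hd : DifferentiableAt ℝ v x := (hv.differentiable two_ne_zero) x
  have hD : DifferentiableAt ℝ (fderiv ℝ v) x :=
    ((hv.fderiv_right (m := 1) le_rfl).differentiable one_ne_zero) x
  rw [fderiv_fderiv_apply_self_apply hv x (v x), fderiv_clm_apply hD hd, add_apply,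
    ContinuousLinearMap.comp_apply, ContinuousLinearMap.flip_apply, ← fderiv_apply_const_apply hD (v x) x]
  abel

end Radial

/-! ## Exchange of `∂ₜ` with `Δ`, `∇` and the convective term on the open slab -/

section Exchange

variable {V : ℝ → ℝ³ → ℝ³} {Q : ℝ → ℝ³ → ℝ} {t : ℝ}

/-- `∂ₜ(ΔV) = Δ(∂ₜV)` on the open backward slab (exchange at order two, `hasDerivAt_iteratedFDeriv_slice`). [folklore] -/
private theorem hasDerivAt_laplacian_slice (hV : IsSmoothSpaceTimeOn (Iio (0 : ℝ)) V) (ht : t < 0) (x : ℝ³) :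
    HasDerivAt (fun s => (Δ (V s)) x) ((Δ (fun y => deriv (fun s => V s y) t)) x) t := by
  set b := stdOrthonormalBasis ℝ ℝ³
  have hfun : (fun s => (Δ (V s)) x) = fun s => ∑ i, iteratedFDeriv ℝ 2 (V s) x ![b i, b i] := by
    funext s
    rw [InnerProductSpace.laplacian_eq_iteratedFDeriv_orthonormalBasis (V s) b]
  rw [hfun, InnerProductSpace.laplacian_eq_iteratedFDeriv_orthonormalBasis _ b]
  refine HasDerivAt.fun_sum fun i _ => ?_
  have hd := hasDerivAt_iteratedFDeriv_slice hV isOpen_Iio 2 t ht x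
  have h := (ContinuousMultilinearMap.apply ℝ (fun _ : Fin 2 => ℝ³) ℝ³ ![b i, b i]).hasFDerivAt.comp_hasDerivAt t hd
  simpa [Function.comp_def, ContinuousMultilinearMap.apply_apply] using h

/-- `∂ₜ(∇Q) = ∇(∂ₜQ)` on the open backward slab (`hasDerivAt_fderiv_slice_clm` and the Riesz map). [folklore] -/
private theorem hasDerivAt_gradient_slice (hQ : IsSmoothSpaceTimeOn (Iio (0 : ℝ)) Q) (ht : t < 0) (x : ℝ³) :
    HasDerivAt (fun s => gradient (Q s) x) (gradient (fun y => deriv (fun s => Q s y) t) x) t := by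
  have h := hQ.hasDerivAt_fderiv_slice_clm isOpen_Iio ht x
  exact ((InnerProductSpace.toDual ℝ ℝ³).symm.toContinuousLinearEquiv.toContinuousLinearMap.hasFDerivAt).comp_hasDerivAt t h

/-- `∂ₜ((V·∇)V) = ((∂ₜV)·∇)V + (V·∇)(∂ₜV)` on the open backward slab (product rule with
`hasDerivAt_fderiv_slice_clm`). [folklore] -/
private theorem hasDerivAt_convect_self_slice (hV : IsSmoothSpaceTimeOn (Iio (0 : ℝ)) V) (ht : t < 0) (x : ℝ³) :
    HasDerivAt (fun s => fderiv ℝ (V s) x (V s x))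
      (fderiv ℝ (fun y => deriv (fun s => V s y) t) x (V t x) + fderiv ℝ (V t) x (deriv (fun s => V s x) t)) t :=
  (hV.hasDerivAt_fderiv_slice_clm isOpen_Iio ht x).clm_apply (hV.hasDerivAt_timeLine isOpen_Iio ht x)

end Exchange


/-! ## The scaling generator of a classical solution -/

section Generator

variable {V : ℝ → ℝ³ → ℝ³} {Q : ℝ → ℝ³ → ℝ}

/-- The scaling generator `V + (x·∇)V + 2t∂ₜV` of a field jointly smooth on the open backward slab is jointly
smooth there. [folklore] -/
private theorem isSmoothSpaceTimeOn_scalingGenerator (hV : IsSmoothSpaceTimeOn (Iio (0 : ℝ)) V) :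
    IsSmoothSpaceTimeOn (Iio (0 : ℝ))
      (fun t x => V t x + fderiv ℝ (V t) x x + (2 * t) • deriv (fun s => V s x) t) := by
  have hD : IsSmoothSpaceTimeOn (Iio (0 : ℝ)) (fun t x => fderiv ℝ (V t) x) :=
    hV.isSmoothSpaceTimeOn_fderiv_of_isOpen isOpen_Iio
  have hX : IsSmoothSpaceTimeOn (Iio (0 : ℝ)) (fun (_ : ℝ) (x : ℝ³) => x) :=
    isSmoothSpaceTimeOn_const_time contDiff_id _
  have hW : IsSmoothSpaceTimeOn (Iio (0 : ℝ)) (fun t x => deriv (fun s => V s x) t) :=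
    hV.isSmoothSpaceTimeOn_deriv isOpen_Iio
  have hc : IsSmoothSpaceTimeOn (Iio (0 : ℝ)) (fun (t : ℝ) (_ : ℝ³) => 2 * t) :=
    (contDiff_const.mul contDiff_fst).contDiffOn
  exact (hV.add (hD.clm_apply hX)).add (hc.smul hW)

/-- The scaling-generator pressure `2Q + (x·∇)Q + 2t∂ₜQ` of a scalar field jointly smooth on the open backward
slab is jointly smooth there. [folklore] -/
private theorem isSmoothSpaceTimeOn_scalingGeneratorPressure (hQ : IsSmoothSpaceTimeOn (Iio (0 : ℝ)) Q) :
    IsSmoothSpaceTimeOn (Iio (0 : ℝ))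
      (fun t x => 2 * Q t x + fderiv ℝ (Q t) x x + 2 * t * deriv (fun s => Q s x) t) := by
  have hD : IsSmoothSpaceTimeOn (Iio (0 : ℝ)) (fun t x => fderiv ℝ (Q t) x) :=
    hQ.isSmoothSpaceTimeOn_fderiv_of_isOpen isOpen_Iio
  have hX : IsSmoothSpaceTimeOn (Iio (0 : ℝ)) (fun (_ : ℝ) (x : ℝ³) => x) :=
    isSmoothSpaceTimeOn_const_time contDiff_id _
  have hW : IsSmoothSpaceTimeOn (Iio (0 : ℝ)) (fun t x => deriv (fun s => Q s x) t) :=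
    hQ.isSmoothSpaceTimeOn_deriv isOpen_Iio
  have hc : IsSmoothSpaceTimeOn (Iio (0 : ℝ)) (fun (t : ℝ) (_ : ℝ³) => 2 * t) :=
    (contDiff_const.mul contDiff_fst).contDiffOn
  have h2 : IsSmoothSpaceTimeOn (Iio (0 : ℝ)) (fun (_ : ℝ) (_ : ℝ³) => (2 : ℝ)) := contDiffOn_const
  exact ((h2.mul hQ).add (hD.clm_apply hX)).add (hc.mul hW)

/-- The scaling generator of a classical solution is divergence free: `div V = 0`, `div((x·∇)V) = 0`
(`divergence_fderiv_apply_self_eq_zero`) and `div ∂ₜV = ∂ₜ div V = 0` (`divergence_deriv_time_eq_zero`). [folklore] -/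
private theorem isDivFree_scalingGenerator (hcl : IsClassicalNSSolutionOn (Iio (0 : ℝ)) 1 0 V Q) {t : ℝ}
    (ht : t < 0) :
    VectorCalculus.IsDivFree (fun x => V t x + fderiv ℝ (V t) x x + (2 * t) • deriv (fun s => V s x) t) := by
  intro x
  have htS : t ∈ Iio (0 : ℝ) := ht
  have hv : ContDiff ℝ ∞ (V t) := hcl.contDiff_velocity htS
  have hv2 : ContDiff ℝ 2 (V t) := contDiff_infty.1 hv 2
  have hw : ContDiff ℝ ∞ (fun y => deriv (fun s => V s y) t) :=
    (hcl.smooth_velocity.isSmoothSpaceTimeOn_deriv isOpen_Iio).contDiff_slice htS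
  have hvd : DifferentiableAt ℝ (V t) x := hv.differentiable (by simp) x
  have hgd : DifferentiableAt ℝ (fun y => fderiv ℝ (V t) y y) x :=
    ((hv.fderiv_right (m := ∞) le_rfl).differentiable (by simp) x).clm_apply differentiableAt_id
  have hwd : DifferentiableAt ℝ (fun y => deriv (fun s => V s y) t) x := hw.differentiable (by simp) x
  have h12 : DifferentiableAt ℝ (fun y => V t y + fderiv ℝ (V t) y y) x := hvd.add hgd
  have h3 : DifferentiableAt ℝ (fun y => (2 * t) • deriv (fun s => V s y) t) x := hwd.const_smul (2 * t)
  rw [divergence_add_apply h12 h3, divergence_add_apply hvd hgd,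
    divergence_const_smul_apply hwd, hcl.divFree t htS x,
    divergence_fderiv_apply_self_eq_zero hv2 (hcl.divFree t htS) x,
    divergence_deriv_time_eq_zero hcl.smooth_velocity isOpen_Iio hcl.divFree htS x]
  ring

/-- **The linearised momentum equation for the scaling generator.**  For a classical solution `(V, Q)` on the
open backward slab, `z = V + (x·∇)V + 2t∂ₜV`, `q_z = 2Q + (x·∇)Q + 2t∂ₜQ` satisfy
`∂ₜz + (V·∇)z + (z·∇)V = Δz − ∇q_z` at every `t < 0`, `x`. [folklore] -/
private theorem scalingGenerator_momentum (hcl : IsClassicalNSSolutionOn (Iio (0 : ℝ)) 1 0 V Q) {t : ℝ}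
    (ht : t < 0) (x : ℝ³) :
    deriv (fun s => V s x + fderiv ℝ (V s) x x + (2 * s) • deriv (fun σ => V σ x) s) t
        + convect (V t) (fun y => V t y + fderiv ℝ (V t) y y + (2 * t) • deriv (fun s => V s y) t) x
        + convect (fun y => V t y + fderiv ℝ (V t) y y + (2 * t) • deriv (fun s => V s y) t) (V t) x =
      (Δ (fun y => V t y + fderiv ℝ (V t) y y + (2 * t) • deriv (fun s => V s y) t)) x
        - gradient (fun y => 2 * Q t y + fderiv ℝ (Q t) y y + 2 * t * deriv (fun s => Q s y) t) x := by
  have hS : IsOpen (Iio (0 : ℝ)) := isOpen_Iio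
  have htS : t ∈ Iio (0 : ℝ) := ht
  have hVs : IsSmoothSpaceTimeOn (Iio (0 : ℝ)) V := hcl.smooth_velocity
  have hQs : IsSmoothSpaceTimeOn (Iio (0 : ℝ)) Q := hcl.smooth_pressure
  have hWs : IsSmoothSpaceTimeOn (Iio (0 : ℝ)) (fun s y => deriv (fun σ => V σ y) s) :=
    hVs.isSmoothSpaceTimeOn_deriv hS
  have hPs : IsSmoothSpaceTimeOn (Iio (0 : ℝ)) (fun s y => deriv (fun σ => Q σ y) s) :=
    hQs.isSmoothSpaceTimeOn_deriv hS
  -- the slices at time `t`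
  have hv : ContDiff ℝ ∞ (V t) := hcl.contDiff_velocity htS
  have hq : ContDiff ℝ ∞ (Q t) := hcl.contDiff_pressure htS
  have hw : ContDiff ℝ ∞ (fun y => deriv (fun s => V s y) t) := hWs.contDiff_slice htS
  have hp : ContDiff ℝ ∞ (fun y => deriv (fun s => Q s y) t) := hPs.contDiff_slice htS
  have hv2 : ContDiff ℝ 2 (V t) := contDiff_infty.1 hv 2
  have hv3 : ContDiff ℝ 3 (V t) := contDiff_infty.1 hv 3
  have hq2 : ContDiff ℝ 2 (Q t) := contDiff_infty.1 hq 2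
  have hw2 : ContDiff ℝ 2 (fun y => deriv (fun s => V s y) t) := contDiff_infty.1 hw 2
  have hDv : ContDiff ℝ ∞ (fderiv ℝ (V t)) := hv.fderiv_right (m := ∞) le_rfl
  have hDq : ContDiff ℝ ∞ (fderiv ℝ (Q t)) := hq.fderiv_right (m := ∞) le_rfl
  have hg : ContDiff ℝ ∞ (fun y => fderiv ℝ (V t) y y) := hDv.clm_apply contDiff_id
  have hgq : ContDiff ℝ ∞ (fun y => fderiv ℝ (Q t) y y) := hDq.clm_apply contDiff_id
  have hg2 : ContDiff ℝ 2 (fun y => fderiv ℝ (V t) y y) := contDiff_infty.1 hg 2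
  -- differentiability at `x`
  have hvd : DifferentiableAt ℝ (V t) x := hv.differentiable (by simp) x
  have hDvd : DifferentiableAt ℝ (fderiv ℝ (V t)) x := hDv.differentiable (by simp) x
  have hgd : DifferentiableAt ℝ (fun y => fderiv ℝ (V t) y y) x := hg.differentiable (by simp) x
  have hwd : DifferentiableAt ℝ (fun y => deriv (fun s => V s y) t) x := hw.differentiable (by simp) x
  have hqd : DifferentiableAt ℝ (Q t) x := hq.differentiable (by simp) x
  have hgqd : DifferentiableAt ℝ (fun y => fderiv ℝ (Q t) y y) x := hgq.differentiable (by simp) x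
  have hpd : DifferentiableAt ℝ (fun y => deriv (fun s => Q s y) t) x := hp.differentiable (by simp) x
  have hΔd : DifferentiableAt ℝ (Δ (V t)) x := differentiable_laplacian hv3 x
  have hGd : DifferentiableAt ℝ (gradient (Q t)) x :=
    (((InnerProductSpace.toDual ℝ ℝ³).symm.contDiff.comp (hq2.fderiv_right (m := 1) le_rfl)).differentiable
      one_ne_zero) x
  have hNd : DifferentiableAt ℝ (fun y => fderiv ℝ (V t) y (V t y)) x := hDvd.clm_apply hvd
  -- the momentum equation at time `t`, as a function of `x`, and its radial derivative
  have hMfun : (fun y => deriv (fun s => V s y) t) =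
      fun y => (Δ (V t)) y - gradient (Q t) y - fderiv ℝ (V t) y (V t y) := by
    funext y
    have hm := hcl.momentum t htS y
    rw [timeDerivWithin_eq_deriv hS htS] at hm
    simp only [convect_apply, one_smul, Pi.zero_apply, add_zero] at hm
    exact eq_sub_of_add_eq hm
  have hM0 : deriv (fun s => V s x) t = (Δ (V t)) x - gradient (Q t) x - fderiv ℝ (V t) x (V t x) :=
    congrFun hMfun x
  have hM1 : fderiv ℝ (fun y => deriv (fun s => V s y) t) x x =
      fderiv ℝ (Δ (V t)) x x - fderiv ℝ (gradient (Q t)) x x - fderiv ℝ (fun y => fderiv ℝ (V t) y (V t y)) x x := by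
    have h12 : DifferentiableAt ℝ (fun y => (Δ (V t)) y - gradient (Q t) y) x := hΔd.sub hGd
    rw [hMfun, fderiv_fun_sub h12 hNd, fderiv_fun_sub hΔd hGd]
    rfl
  -- the momentum equation differentiated in time at `(t, x)`
  have hM2 : deriv (fun s => deriv (fun σ => V σ x) s) t =
      (Δ (fun y => deriv (fun s => V s y) t)) x - gradient (fun y => deriv (fun s => Q s y) t) x
        - (fderiv ℝ (fun y => deriv (fun s => V s y) t) x (V t x)
            + fderiv ℝ (V t) x (deriv (fun s => V s x) t)) := by
    have heq : (fun s => (Δ (V s)) x - gradient (Q s) x - fderiv ℝ (V s) x (V s x)) =ᶠ[𝓝 t]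
        fun s => deriv (fun σ => V σ x) s := by
      filter_upwards [hS.mem_nhds htS] with s hs
      have hm := hcl.momentum s hs x
      rw [timeDerivWithin_eq_deriv hS hs] at hm
      simp only [convect_apply, one_smul, Pi.zero_apply, add_zero] at hm
      exact (eq_sub_of_add_eq hm).symm
    have hd := ((hasDerivAt_laplacian_slice hVs ht x).fun_sub (hasDerivAt_gradient_slice hQs ht x)).fun_sub
      (hasDerivAt_convect_self_slice hVs ht x)
    exact (hd.congr_of_eventuallyEq heq.symm).deriv
  -- the time derivative of the generator
  have hT1 : deriv (fun s => V s x + fderiv ℝ (V s) x x + (2 * s) • deriv (fun σ => V σ x) s) t =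
      deriv (fun s => V s x) t + fderiv ℝ (fun y => deriv (fun s => V s y) t) x x
        + ((2 * t) • deriv (fun s => deriv (fun σ => V σ x) s) t + (2 : ℝ) • deriv (fun s => V s x) t) := by
    have h0 := hVs.hasDerivAt_timeLine hS htS x
    have h1 := hVs.hasDerivAt_fderiv_slice hS htS x x
    have h2 := hWs.hasDerivAt_timeLine hS htS x
    have hc : HasDerivAt (fun s : ℝ => 2 * s) 2 t := by
      simpa using (hasDerivAt_id' t).const_mul (2 : ℝ)
    exact ((h0.fun_add h1).fun_add (hc.fun_smul h2)).deriv
  -- linearity of the spatial operators on `z = V + (x·∇)V + 2t∂ₜV`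
  have hΔz : (Δ (fun y => V t y + fderiv ℝ (V t) y y + (2 * t) • deriv (fun s => V s y) t)) x =
      (Δ (V t)) x + (Δ (fun y => fderiv ℝ (V t) y y)) x + (2 * t) • (Δ (fun y => deriv (fun s => V s y) t)) x := by
    have e : (fun y => V t y + fderiv ℝ (V t) y y + (2 * t) • deriv (fun s => V s y) t) =
        V t + (fun y => fderiv ℝ (V t) y y) + (2 * t) • (fun y => deriv (fun s => V s y) t) := rfl
    have h12 : ContDiffAt ℝ 2 (V t + fun y => fderiv ℝ (V t) y y) x := (hv2.add hg2).contDiffAt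
    have h3 : ContDiffAt ℝ 2 ((2 * t) • fun y => deriv (fun s => V s y) t) x :=
      (hw2.const_smul (2 * t)).contDiffAt
    rw [e, h12.laplacian_add h3, hv2.contDiffAt.laplacian_add hg2.contDiffAt,
      InnerProductSpace.laplacian_smul _ hw2.contDiffAt]
  have hGz : gradient (fun y => 2 * Q t y + fderiv ℝ (Q t) y y + 2 * t * deriv (fun s => Q s y) t) x =
      (2 : ℝ) • gradient (Q t) x + gradient (fun y => fderiv ℝ (Q t) y y) x
        + (2 * t) • gradient (fun y => deriv (fun s => Q s y) t) x := by
    have hF : HasFDerivAt (fun y => 2 * Q t y + fderiv ℝ (Q t) y y + 2 * t * deriv (fun s => Q s y) t)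
        ((2 : ℝ) • fderiv ℝ (Q t) x + fderiv ℝ (fun y => fderiv ℝ (Q t) y y) x
          + (2 * t) • fderiv ℝ (fun y => deriv (fun s => Q s y) t) x) x :=
      ((hqd.hasFDerivAt.const_mul (2 : ℝ)).add hgqd.hasFDerivAt).add (hpd.hasFDerivAt.const_mul (2 * t))
    unfold gradient
    rw [hF.fderiv, map_add, map_add, map_smul, map_smul]
  have hC1 : convect (V t) (fun y => V t y + fderiv ℝ (V t) y y + (2 * t) • deriv (fun s => V s y) t) x =
      fderiv ℝ (V t) x (V t x) + fderiv ℝ (fun y => fderiv ℝ (V t) y y) x (V t x)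
        + (2 * t) • fderiv ℝ (fun y => deriv (fun s => V s y) t) x (V t x) := by
    have hF : HasFDerivAt (fun y => V t y + fderiv ℝ (V t) y y + (2 * t) • deriv (fun s => V s y) t)
        (fderiv ℝ (V t) x + fderiv ℝ (fun y => fderiv ℝ (V t) y y) x
          + (2 * t) • fderiv ℝ (fun y => deriv (fun s => V s y) t) x) x :=
      (hvd.hasFDerivAt.add hgd.hasFDerivAt).add (hwd.hasFDerivAt.const_smul (2 * t))
    rw [convect_apply, hF.fderiv]
    rfl
  have hC2 : convect (fun y => V t y + fderiv ℝ (V t) y y + (2 * t) • deriv (fun s => V s y) t) (V t) x =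
      fderiv ℝ (V t) x (V t x) + fderiv ℝ (V t) x (fderiv ℝ (V t) x x)
        + (2 * t) • fderiv ℝ (V t) x (deriv (fun s => V s x) t) := by
    rw [convect_apply, map_add, map_add, map_smul]
  -- the commutators with `x·∇`
  have hA2 := laplacian_fderiv_apply_self hv3 x
  have hA3 := gradient_fderiv_apply_self hq2 x
  have hA5 : fderiv ℝ (fun y => fderiv ℝ (V t) y y) x (V t x) =
      fderiv ℝ (fun y => fderiv ℝ (V t) y (V t y)) x x + fderiv ℝ (V t) x (V t x)
        - fderiv ℝ (V t) x (fderiv ℝ (V t) x x) :=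
    eq_sub_of_add_eq (convect_fderiv_apply_self_add hv2 x)
  -- assemble
  rw [hT1, hC1, hC2, hΔz, hGz, hA2, hA3, hM1, hM2, hA5, hM0]
  module

end Generator

/-- **STUB P2 (line `SketchIdeator6`, skeleton v2): the scaling generator solves the linearised system.**
For a classical solution `(V, Q)` of Navier–Stokes on `(−∞,0) × ℝ³`, the scaling generator
`z = V + x·∇V + 2t∂ₜV` (`(d/dλ)|₁` of `λV(λ²t,λx)`) with the pressure `2Q + x·∇Q + 2t∂ₜQ` (`(d/dλ)|₁` of
`λ²Q(λ²t,λx)`) is jointly smooth, divergence free and solves `∂ₜz + (V·∇)z + (z·∇)V = Δz − ∇(2Q + x·∇Q + 2t∂ₜQ)`.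
[folklore] -/
theorem stub_scalingGeneratorSolvesLinearised :
    ∀ (V : ℝ → ℝ³ → ℝ³) (Q : ℝ → ℝ³ → ℝ), IsClassicalNSSolutionOn (Iio (0 : ℝ)) 1 0 V Q →
      IsSmoothSpaceTimeOn (Iio (0 : ℝ))
        (fun t x => V t x + fderiv ℝ (V t) x x + (2 * t) • deriv (fun s => V s x) t) ∧
      IsSmoothSpaceTimeOn (Iio (0 : ℝ))
        (fun t x => 2 * Q t x + fderiv ℝ (Q t) x x + 2 * t * deriv (fun s => Q s x) t) ∧
      (∀ t < 0, VectorCalculus.IsDivFree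
        (fun x => V t x + fderiv ℝ (V t) x x + (2 * t) • deriv (fun s => V s x) t)) ∧
      (∀ t < 0, ∀ x : ℝ³,
        deriv (fun s => V s x + fderiv ℝ (V s) x x + (2 * s) • deriv (fun σ => V σ x) s) t
          + convect (V t) (fun y => V t y + fderiv ℝ (V t) y y + (2 * t) • deriv (fun s => V s y) t) x
          + convect (fun y => V t y + fderiv ℝ (V t) y y + (2 * t) • deriv (fun s => V s y) t) (V t) x =
        (Δ (fun y => V t y + fderiv ℝ (V t) y y + (2 * t) • deriv (fun s => V s y) t)) x
          - gradient (fun y => 2 * Q t y + fderiv ℝ (Q t) y y + 2 * t * deriv (fun s => Q s y) t) x) := by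
  intro V Q hcl
  exact ⟨isSmoothSpaceTimeOn_scalingGenerator hcl.smooth_velocity,
    isSmoothSpaceTimeOn_scalingGeneratorPressure hcl.smooth_pressure,
    fun t ht => isDivFree_scalingGenerator hcl ht,
    fun t ht x => scalingGenerator_momentum hcl ht x⟩

end Summit.NavierStokesRegularity.NavierStokesRegularity.Theorems.RellichScarScarRigidity

end
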